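import Summits.QuantumAdvantage.QuantumAdvantage.Theorems.StakeDialA

/-!
# StakeDial — part B: the BUDGET LAW, the DEAD-STAKE LAW, forced outputs, and TIGHTNESS (all cycle lengths)

* §E `budget_law` — on the `(n+1)`-cycle (`n ≥ 2`), a degree-`d` strategy silent outside `M` (`P ∈ silent M`) loses on some
  odd-class pattern whenever some coordinate set `T` has `topChar T (canon n) ≠ 0` and `|M|·(4d+2) < |T|`
  (the UNCERTAINTY INEQUALITY `Σ_{non-silent} (4d_g+2) ≥ max {|T| : χ_T(S_n) ≠ 0}` for perfect strategies).
* §I `deadStake_law` — degree-free: if some walk point has all `M`-stakes dead and `S_n = +1` (`u ∈ exposed n M`) then no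
  strategy silent outside `M` is perfect; `forced_output_single_live` — at a point where `g₀` is the only live stake of
  `M`, perfection forces `ζ_{g₀}(u) = [S_n(u) = +1]`; its dual `singleLive_law` — if no degree-`4d` polynomial agrees
  with `[S_n = +1]` on the single-live set of some column, no degree-`d` strategy silent outside `M` is perfect.
* §H TIGHTNESS — `pairStrategy` / `adjacentPair_perfect`: with the rest silent, two free (unbounded-degree) outputs on an
  ADJACENT pair `{k, k+1}` are PERFECT on the odd class of every cycle; hence `no_degreeFree_pair_law`: there is no
  silent-complement law with the bare count `|M| ≤ 2` in place of the degree budget.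

Predicates are `Set`-valued data (`silent M`, `exposed n M`, membership lemmas `Iff.rfl`); no `Prop`-valued `def`.
-/

set_option linter.dupNamespace false
set_option linter.style.longLine false

namespace Summit.QuantumAdvantage.QuantumAdvantage.Theorems.StakeDial

open Finset
open Literature.Computability.QuantumComplexity.RingHLF (Rel)
open Literature.Computability.MetaComplexity.Smolensky
open Summit.QuantumAdvantage.AdviceFreeQNC0 (OddZeros xOfU uVec uExt tGuess ringWinU walkExp wtPrefix
  rel_iff_ringWinU xOfU_uVec card_odd_filter_ge)

variable {n : ℕ}

/-! ### E. THE BUDGET LAW -/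

/-- The strategies SILENT outside `M` (data, `Set`-valued): the columns `g ∉ M` never output `1`. -/
def silent {m : ℕ} (M : Finset (Fin m)) : Set (Fin m → CubeFn (ZMod 3) m) :=
  {P | ∀ g, g ∉ M → ∀ x, P g x ≠ 1}

/-- Membership in `silent M`, definitionally. -/
theorem mem_silent {m : ℕ} {M : Finset (Fin m)} {P : Fin m → CubeFn (ZMod 3) m} :
    P ∈ silent M ↔ ∀ g, g ∉ M → ∀ x, P g x ≠ 1 := Iff.rfl

/-- **THE BUDGET LAW (soundness engine, PROVED).** On the `(n+1)`-cycle, a degree-`d` strategy silent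
outside `M` loses on some odd-class pattern as soon as some coordinate set `T` of the walk cube with
`χ_T(S_n) ≠ 0` has `|T| > |M|·(4d+2)`:  the product normal form has degree `≤ |M|(4d+2) < |T|`, so
`χ_T` kills it, while `χ_T(−S_n) = −χ_T(S_n) ≠ 0`. -/
theorem budget_law (hn : 2 ≤ n) {d : ℕ} (P : Fin (n + 1) → CubeFn (ZMod 3) (n + 1))
    (hP : ∀ i, P i ∈ lowDeg (ZMod 3) (n + 1) d) (M : Finset (Fin (n + 1))) (hM : P ∈ silent M)
    (T : Finset (Fin n)) (hT : topChar T (canon n) ≠ 0) (hB : M.card * (4 * d + 2) < T.card) :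
    ∃ x : Fin (n + 1) → Bool, OddZeros x ∧ ¬ Rel x (fun i => decide (P i x = 1)) := by
  by_contra hcon
  push Not at hcon
  have hid := prod_eq_neg_canon hn P hcon
  have hidM : ∀ u, (∏ g ∈ M, (1 + zeta (P g) * rho n g.val)) u = - canon n u := by
    intro u
    rw [← hid u, Finset.prod_apply]
    simp only [Pi.add_apply, Pi.mul_apply, Pi.one_apply]
    refine Finset.prod_subset (Finset.subset_univ M) fun g _ hg => ?_
    have hz : zeta (P g) u = 0 := by
      unfold zeta; rw [decide_eq_false (hM g hg (xOfU u))]; rfl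
    rw [hz, zero_mul, add_zero]
  have hGm : (∏ g ∈ M, (1 + zeta (P g) * rho n g.val)) ∈ lowDeg (ZMod 3) n (M.card * (4 * d + 2)) :=
    prod_mem_lowDeg_card_mul M _ fun g _ => factor_mem (hP g) g.val
  have h0 := topChar_eq_zero_of_mem_lowDeg hB hGm
  have h1 : topChar T (∏ g ∈ M, (1 + zeta (P g) * rho n g.val)) = - topChar T (canon n) := by
    unfold topChar
    rw [← Finset.sum_neg_distrib]
    refine Finset.sum_congr rfl fun u _ => ?_
    rw [hidM u]; ring
  rw [h1, neg_eq_zero] at h0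
  exact hT h0


section DeadStake

/-- The EXPOSED dead points of the support `M` on the `(n+1)`-cycle (data, `Set`-valued): walk points with
all `M`-stakes dead and canonical sign `S_n = +1`. -/
def exposed (n : ℕ) (M : Finset (Fin (n + 1))) : Set (Fin n → Bool) :=
  {u | (∀ g ∈ M, rho n g.val u = 0) ∧ canon n u = 1}

/-- Membership in `exposed n M`, definitionally. -/
theorem mem_exposed {M : Finset (Fin (n + 1))} {u : Fin n → Bool} :
    u ∈ exposed n M ↔ (∀ g ∈ M, rho n g.val u = 0) ∧ canon n u = 1 := Iff.rfl

/-- **THE DEAD-STAKE LAW (PROVED, degree-free).** A strategy silent outside an exposed support loses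
somewhere on the odd class. -/
theorem deadStake_law (hn : 2 ≤ n) (P : Fin (n + 1) → CubeFn (ZMod 3) (n + 1))
    (M : Finset (Fin (n + 1))) (hM : P ∈ silent M) (hE : ∃ u, u ∈ exposed n M) :
    ∃ x : Fin (n + 1) → Bool, OddZeros x ∧ ¬ Rel x (fun i => decide (P i x = 1)) := by
  by_contra hcon
  push Not at hcon
  obtain ⟨u, hdead, hS⟩ := hE
  have hid := prod_eq_neg_canon hn P hcon u
  have h1 : ∏ g : Fin (n + 1), (1 + zeta (P g) u * rho n g.val u) = 1 := by
    refine Finset.prod_eq_one fun g _ => ?_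
    by_cases hg : g ∈ M
    · rw [hdead g hg, mul_zero, add_zero]
    · have hz : zeta (P g) u = 0 := by
        unfold zeta; rw [decide_eq_false (hM g hg (xOfU u))]; rfl
      rw [hz, zero_mul, add_zero]
  rw [h1, hS] at hid
  exact absurd hid (by decide)

/-- StakeDialB helper `ind_eq_one_of_ne_zero` (decomp-qadv land package; see the module docstring). -/
theorem ind_eq_one_of_ne_zero {b : Bool} (h : ind b ≠ 0) : ind b = 1 := by
  cases b
  · exact absurd rfl h
  · rfl

/-- **Forced outputs (PROVED, degree-free).** At a walk point where `g₀` is the ONLY live stake of the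
support `M` of a perfect strategy, the normal form FORCES the output event:
`ζ_{g₀}(u) = [S_n(u) = +1]`.  (On a covering support the sign function, restricted to the single-live
set of each column, must therefore agree with a degree-`4d` function — census ask C5.) -/
theorem forced_output_single_live (hn : 2 ≤ n) (P : Fin (n + 1) → CubeFn (ZMod 3) (n + 1))
    (hperf : ∀ x : Fin (n + 1) → Bool, OddZeros x → Rel x (fun i => decide (P i x = 1)))
    (M : Finset (Fin (n + 1))) (hM : P ∈ silent M) (u : Fin n → Bool) (g₀ : Fin (n + 1))
    (hlive : rho n g₀.val u ≠ 0) (hdead : ∀ g ∈ M, g ≠ g₀ → rho n g.val u = 0) :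
    zeta (P g₀) u = ind (decide (canon n u = 1)) := by
  have hid := prod_eq_neg_canon hn P hperf u
  rw [← Finset.mul_prod_erase univ _ (mem_univ g₀)] at hid
  have h1 : ∏ g ∈ univ.erase g₀, (1 + zeta (P g) u * rho n g.val u) = 1 := by
    refine Finset.prod_eq_one fun g hg => ?_
    have hne : g ≠ g₀ := ne_of_mem_erase hg
    by_cases hgM : g ∈ M
    · rw [hdead g hgM hne, mul_zero, add_zero]
    · have hz : zeta (P g) u = 0 := by
        unfold zeta; rw [decide_eq_false (hM g hgM (xOfU u))]; rfl
      rw [hz, zero_mul, add_zero]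
  have hl1 : rho n g₀.val u = 1 := ind_eq_one_of_ne_zero hlive
  rw [h1, mul_one, hl1, mul_one] at hid
  have hc := canon_mul_self (n := n) u
  have hz : zeta (P g₀) u = 0 ∨ zeta (P g₀) u = 1 := by
    unfold zeta; cases decide (P g₀ (xOfU u) = 1)
    · exact Or.inl rfl
    · exact Or.inr rfl
  have key : ∀ c w : ZMod 3, 1 + w = -c → c * c = 1 → (w = 0 ∨ w = 1) →
      w = ind (decide (c = 1)) := by decide
  exact key _ _ hid hc hz

end DeadStake

section SingleLive

/-- **THE SINGLE-LIVE LAW (PROVED).** If no polynomial of degree `≤ 4d` agrees with the sign event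
`[S_n = +1]` on the single-live set of some column `g₀` of the support, then no degree-`d` strategy silent
outside the support is perfect. -/
theorem singleLive_law (hn : 2 ≤ n) {d : ℕ} (P : Fin (n + 1) → CubeFn (ZMod 3) (n + 1))
    (hP : ∀ i, P i ∈ lowDeg (ZMod 3) (n + 1) d) (M : Finset (Fin (n + 1))) (hM : P ∈ silent M)
    (g₀ : Fin (n + 1))
    (hD : ∀ q ∈ lowDeg (ZMod 3) n (4 * d), ∃ u, (rho n g₀.val u ≠ 0 ∧ ∀ g ∈ M, g ≠ g₀ → rho n g.val u = 0) ∧ q u ≠ ind (decide (canon n u = 1))) :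
    ∃ x : Fin (n + 1) → Bool, OddZeros x ∧ ¬ Rel x (fun i => decide (P i x = 1)) := by
  by_contra hcon
  push Not at hcon
  obtain ⟨u, ⟨hl, hd⟩, hq⟩ := hD (zeta (P g₀)) (zeta_mem (hP g₀))
  exact hq (forced_output_single_live hn P hcon M hM u g₀ hl hd)

end SingleLive

/-! ### H. Tightness of the dial's shape: the degree hypothesis of W is NECESSARY (all `n`)

With every other column silent, an ADJACENT PAIR of (unbounded-degree) outputs is already PERFECT on
the odd class: adjacent stakes are never both `≡ 0 (mod 3)`, so one of the two bells can always repair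
the parity of the canonical ring count.  Hence no degree-free silent-complement law exists
(`no_degreeFree_pair_law`): in `SparseColumns3` the budget `|M|(4d+2)` cannot be replaced by `|M|`. -/

section Tightness

/-- StakeDialB helper `wtPrefix_le_succ` (decomp-qadv land package; see the module docstring). -/
theorem wtPrefix_le_succ (u : Fin n → Bool) (g : ℕ) : wtPrefix u g ≤ wtPrefix u (g + 1) := by
  unfold Summit.QuantumAdvantage.AdviceFreeQNC0.wtPrefix
  exact card_le_card fun i hi => by
    rw [mem_filter] at hi ⊢
    exact ⟨hi.1, Nat.lt_succ_of_lt hi.2.1, hi.2.2⟩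

/-- StakeDialB helper `wtPrefix_succ_le` (decomp-qadv land package; see the module docstring). -/
theorem wtPrefix_succ_le (u : Fin n → Bool) {g : ℕ} (hg : g < n) :
    wtPrefix u (g + 1) ≤ wtPrefix u g + 1 := by
  unfold Summit.QuantumAdvantage.AdviceFreeQNC0.wtPrefix
  calc (univ.filter fun i : Fin n => i.val < g + 1 ∧ u i = true).card
      ≤ ((univ.filter fun i : Fin n => i.val < g ∧ u i = true) ∪ {⟨g, hg⟩}).card := by
        refine card_le_card fun i hi => ?_
        rw [mem_union, mem_filter, mem_singleton]
        rw [mem_filter] at hi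
        rcases Nat.lt_succ_iff_lt_or_eq.1 hi.2.1 with h | h
        · exact Or.inl ⟨hi.1, h, hi.2.2⟩
        · exact Or.inr (Fin.ext h)
    _ ≤ (univ.filter fun i : Fin n => i.val < g ∧ u i = true).card + ({⟨g, hg⟩} : Finset (Fin n)).card :=
        card_union_le _ _
    _ = _ := by rw [card_singleton]

/-- The canonical ring count of a pattern (number of canonical bells that ring, walk chart). -/
def cnt (x : Fin (n + 1) → Bool) : ℕ :=
  (univ.filter fun g : Fin (n + 1) =>
    tGuess x g = true ∧ (n + 2 + g.val + walkExp (uVec x) g.val) % 3 ≠ 0).card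

/-- Which of the two adjacent columns `k, k+1` has a live stake. -/
def pick (n k : ℕ) (x : Fin (n + 1) → Bool) : ℕ :=
  if (n + 2 + k + walkExp (uVec x) k) % 3 ≠ 0 then k else k + 1

/-- The pair strategy: silent when the canonical count is already odd, else ring exactly one extra
bell at the live column among `k, k+1`. -/
def zPair (k : ℕ) (x : Fin (n + 1) → Bool) (g : Fin (n + 1)) : Bool :=
  decide (cnt x % 2 = 0 ∧ g.val = pick n k x)

/-- The pair strategy as `𝔽₃`-valued output columns (events `[P_g = 1]`). -/
def pairStrategy (k : ℕ) : Fin (n + 1) → CubeFn (ZMod 3) (n + 1) :=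
  fun g x => if zPair k x g = true then 1 else 0

/-- StakeDialB helper `pairStrategy_event` (decomp-qadv land package; see the module docstring). -/
theorem pairStrategy_event (k : ℕ) (g : Fin (n + 1)) (x : Fin (n + 1) → Bool) :
    decide (pairStrategy k g x = 1) = zPair k x g := by
  unfold pairStrategy
  cases zPair k x g <;> decide

/-- StakeDialB helper `pairStrategy_silent` (decomp-qadv land package; see the module docstring). -/
theorem pairStrategy_silent (k : ℕ) (hk : k + 1 < n + 1) :
    pairStrategy (n := n) k ∈ silent {⟨k, by omega⟩, ⟨k + 1, hk⟩} := by
  intro g hg x h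
  have hz : zPair k x g = true := by rw [← pairStrategy_event, h]; decide
  unfold zPair at hz
  rw [decide_eq_true_eq] at hz
  obtain ⟨_, hv⟩ := hz
  apply hg
  rw [mem_insert, mem_singleton]
  unfold pick at hv
  split_ifs at hv
  · exact Or.inl (Fin.ext hv)
  · exact Or.inr (Fin.ext hv)

/-- StakeDialB helper `pairStrategy_perfect` (decomp-qadv land package; see the module docstring). -/
theorem pairStrategy_perfect (hn : 2 ≤ n) (k : ℕ) (hk : k < n) (x : Fin (n + 1) → Bool)
    (hodd : OddZeros x) : Rel x (fun g => decide (pairStrategy k g x = 1)) := by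
  have hodd' : (univ.filter fun j : Fin (n + 1) => x j = false).card % 2 = 1 := hodd
  refine (rel_iff_ringWinU hn x hodd' (fun x g => decide (pairStrategy k g x = 1))).2 ?_
  unfold Summit.QuantumAdvantage.AdviceFreeQNC0.ringWinU
  rw [decide_eq_true_eq]
  simp only [xOfU_uVec hn x hodd', pairStrategy_event]
  rcases Nat.mod_two_eq_zero_or_one (cnt x) with h0 | h1
  · -- even canonical count: ring one extra bell at the live column `j`
    obtain ⟨j, hj⟩ : ∃ j, pick n k x = j := ⟨_, rfl⟩
    have hjb : k ≤ j ∧ j ≤ k + 1 := by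
      unfold pick at hj; split_ifs at hj <;> omega
    have hjlt : j < n + 1 := by omega
    have hmsk : (n + 2 + j + walkExp (uVec x) j) % 3 ≠ 0 := by
      unfold pick at hj
      split_ifs at hj with hm
      · rw [← hj]; exact hm
      · rw [← hj]
        have hm' : (n + 2 + k + walkExp (uVec x) k) % 3 = 0 := by
          by_contra hc; exact hm hc
        unfold Summit.QuantumAdvantage.AdviceFreeQNC0.walkExp at hm' ⊢
        have h1 := wtPrefix_le_succ (uVec x) k
        have h2 := wtPrefix_succ_le (uVec x) hk
        omega
    obtain ⟨jF, hjF⟩ : ∃ jF : Fin (n + 1), jF.val = j := ⟨⟨j, hjlt⟩, rfl⟩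
    have hzj : zPair k x jF = true := by
      unfold zPair; rw [decide_eq_true_eq]; exact ⟨h0, by rw [hjF, hj]⟩
    have hzo : ∀ g : Fin (n + 1), g ≠ jF → zPair k x g = false := by
      intro g hg
      unfold zPair
      rw [decide_eq_false_iff_not]
      rintro ⟨_, hv⟩
      exact hg (Fin.ext (by rw [hv, hj, hjF]))
    have hmskF : (n + 2 + jF.val + walkExp (uVec x) jF.val) % 3 ≠ 0 := by rw [hjF]; exact hmsk
    have hc : (univ.filter fun g : Fin (n + 1) =>
        tGuess x g = true ∧ (n + 2 + g.val + walkExp (uVec x) g.val) % 3 ≠ 0).card % 2 = 0 := h0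
    by_cases ht : tGuess x jF = true
    · have hmem : jF ∈ univ.filter (fun g : Fin (n + 1) =>
          tGuess x g = true ∧ (n + 2 + g.val + walkExp (uVec x) g.val) % 3 ≠ 0) := by
        rw [mem_filter]; exact ⟨mem_univ _, ht, hmskF⟩
      have hset : (univ.filter fun g : Fin (n + 1) =>
          xor (zPair k x g) (tGuess x g) = true ∧ (n + 2 + g.val + walkExp (uVec x) g.val) % 3 ≠ 0) =
          (univ.filter fun g : Fin (n + 1) =>
            tGuess x g = true ∧ (n + 2 + g.val + walkExp (uVec x) g.val) % 3 ≠ 0).erase jF := by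
        ext g
        rw [mem_erase, mem_filter, mem_filter]
        by_cases hg : g = jF
        · subst hg
          rw [hzj, ht]
          simp
        · rw [hzo g hg, Bool.false_xor]
          exact ⟨fun h => ⟨hg, h⟩, fun h => h.2⟩
      rw [hset, card_erase_of_mem hmem]
      have hpos := card_pos.2 ⟨jF, hmem⟩
      omega
    · have ht' : tGuess x jF = false := by simpa using ht
      have hnmem : jF ∉ univ.filter (fun g : Fin (n + 1) =>
          tGuess x g = true ∧ (n + 2 + g.val + walkExp (uVec x) g.val) % 3 ≠ 0) := by
        rw [mem_filter]; rintro ⟨_, h, _⟩; rw [ht'] at h; exact Bool.false_ne_true h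
      have hset : (univ.filter fun g : Fin (n + 1) =>
          xor (zPair k x g) (tGuess x g) = true ∧ (n + 2 + g.val + walkExp (uVec x) g.val) % 3 ≠ 0) =
          insert jF (univ.filter fun g : Fin (n + 1) =>
            tGuess x g = true ∧ (n + 2 + g.val + walkExp (uVec x) g.val) % 3 ≠ 0) := by
        ext g
        rw [mem_insert, mem_filter, mem_filter]
        by_cases hg : g = jF
        · subst hg
          rw [hzj, ht']
          simp only [mem_univ, true_and, Bool.xor_false, true_or, iff_true]
          exact hmskF
        · rw [hzo g hg, Bool.false_xor]
          exact ⟨fun h => Or.inr h, fun h => h.resolve_left hg⟩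
      rw [hset, card_insert_of_notMem hnmem]
      omega
  · -- odd canonical count: stay silent
    have hz : ∀ g : Fin (n + 1), zPair k x g = false := fun g =>
      decide_eq_false fun h => by omega
    simp only [hz, Bool.false_xor]
    exact h1

/-- **Adjacent pairs are perfect** (every cycle length `n + 1 ≥ 3`, every adjacent pair `k, k+1 ≤ n`). -/
theorem adjacentPair_perfect (hn : 2 ≤ n) (k : ℕ) (hk : k < n) :
    ∃ P : Fin (n + 1) → CubeFn (ZMod 3) (n + 1),
      P ∈ silent {⟨k, by omega⟩, ⟨k + 1, by omega⟩} ∧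
        ∀ x : Fin (n + 1) → Bool, OddZeros x → Rel x (fun i => decide (P i x = 1)) :=
  ⟨pairStrategy k, pairStrategy_silent k (by omega), fun x hx => pairStrategy_perfect hn k hk x hx⟩

/-- **No degree-free silent-complement law**: the budget `|M|(4d+2)` of `SparseColumns3` cannot be
replaced by the bare count `|M|` — already `|M| ≤ 2` admits perfect strategies at every length. -/
theorem no_degreeFree_pair_law :
    ¬ (∃ n₀ : ℕ, ∀ n ≥ n₀, ∀ P : Fin n → CubeFn (ZMod 3) n, ∀ M : Finset (Fin n), P ∈ silent M →
        M.card ≤ 2 → ∃ x : Fin n → Bool, OddZeros x ∧ ¬ Rel x (fun i => decide (P i x = 1))) := by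
  rintro ⟨n₀, h⟩
  obtain ⟨P, hS, hperf⟩ := adjacentPair_perfect (n := n₀ + 2) (by omega) 0 (by omega)
  obtain ⟨x, hx, hnot⟩ := h (n₀ + 2 + 1) (by omega) P _ hS (Finset.card_le_two)
  exact hnot (hperf x hx)

end Tightness
end Summit.QuantumAdvantage.QuantumAdvantage.Theorems.StakeDial
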